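import Summits.QuantumAdvantage.AdviceFreeQNC0.AffineStakes
import HarnessLib

/-!
# Cell qa-qnc0 — 𝔽₂-calculus for affine stake strategies (planner qa-qnc0-p1 g19, ROUND-18 §3.6,
steps (3)–(4); service file for `AffineStakesHard.lean`)

Everything about the win bit of an `𝔽₂`-affine stake strategy `affineStrategy A cv`
(`AffineStakes.lean`) is a computation in `𝔽₂ = ZMod 2` (`bitVal`):

* `aff A cv x k = c_k + Σ_i A_{ki} x_i` is the stake in `𝔽₂` (`bitVal_stake_affine`), and on the odd
  class `WIN(x) ⟺ wval A cv (J x) x = 1`, `wval A cv v x = Σ_k v_k · aff_k(x)` (`rel_affine_iff`);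
* flipping the bits in `P` adds the column sums: `wval v (x ⊕ 1_P) = wval v x + Σ_{i ∈ P} colSum v i`,
  `colSum A v i = Σ_k v_k A_{ki}` (`wval_flipAt`); toggling the vector at `s` adds `aff_s`
  (`wval_flipAt_left`);
* RADIUS-1 read matrices (`IsRadiusOne A`: row `k` vanishes off `{k-1, k, k+1}`): three-term formulas
  for `aff` and `colSum` (`aff_eq_three`, `colSum_eq_three`) and, at a particle `i` of a hard-core `v`,
  `colSum v i = kap A i = A_{i-1,i} + A_{i+1,i}` (`colSum_particle`) — the planner's `κ_i = γ_{i-1} + α_{i+1}`.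

WHAT THIS IS NOT: no probability estimate here; `AffineStakesHardOdd3` is assembled in the next file;
crux 22907 untouched; separation NOT moved.
-/

namespace Summit.QuantumAdvantage.AdviceFreeQNC0.Fib19

open Finset Literature.Computability.QuantumComplexity Literature.Computability.QuantumComplexity.RingHLF

variable {n : ℕ}

/-! ### Definitions -/

/-- The stake of the affine strategy in `𝔽₂`: `c_k + Σ_i A_{ki} x_i`. -/
def aff (A : Fin n → Fin n → Bool) (cv : Fin n → Bool) (x : Fin n → Bool) (k : Fin n) : ZMod 2 :=
  bitVal (cv k) + ∑ i, bitVal (A k i) * bitVal (x i)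

/-- The pairing `Σ_k v_k · aff_k(x)` in `𝔽₂` (the win bit when `v = J(x)`). -/
def wval (A : Fin n → Fin n → Bool) (cv : Fin n → Bool) (v x : Fin n → Bool) : ZMod 2 :=
  ∑ k, bitVal (v k) * aff A cv x k

/-- Column sum `Σ_k v_k A_{ki}`: the `v`-weighted number of bells reading bit `i`. -/
def colSum (A : Fin n → Fin n → Bool) (v : Fin n → Bool) (i : Fin n) : ZMod 2 :=
  ∑ k, bitVal (v k) * bitVal (A k i)

/-- Radius-1 read matrix: row `k` vanishes off `{k-1, k, k+1}`. -/
def IsRadiusOne (A : Fin n → Fin n → Bool) : Prop :=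
  ∀ k i : Fin n, i ≠ prv k → i ≠ k → i ≠ nxt k → A k i = false

/-- `κ_i = A_{i-1,i} + A_{i+1,i}` (the coefficient of the coin `x_i` in the win bit on a fibre where `i`
is a particle; planner's `κ_i = γ_{i-1} + α_{i+1}`). -/
def kap (A : Fin n → Fin n → Bool) (i : Fin n) : ZMod 2 := bitVal (A (prv i) i) + bitVal (A (nxt i) i)

/-! ### Bits in `𝔽₂` -/

/-- A parity bit in `𝔽₂` is the residue. -/
theorem bitVal_decide_mod_two (N : ℕ) : bitVal (decide (N % 2 = 1)) = (N : ZMod 2) := by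
  rcases Nat.mod_two_eq_zero_or_one N with h | h
  · rw [h, (ZMod.natCast_eq_zero_iff_even.2 (Nat.even_iff.2 h))]; decide
  · rw [h, (ZMod.natCast_eq_one_iff_odd.2 (Nat.odd_iff.2 h))]; decide

/-- A row parity in `𝔽₂`. -/
theorem bitVal_rowParity (a x : Fin n → Bool) : bitVal (rowParity a x) = ∑ i, bitVal (a i) * bitVal (x i) := by
  unfold rowParity
  rw [bitVal_decide_mod_two, natCast_card_filter]
  refine sum_congr rfl fun i _ => ?_
  cases a i <;> cases x i <;> simp [bitVal]

/-- The stake of the affine strategy in `𝔽₂`. -/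
theorem bitVal_stake_affine (A : Fin n → Fin n → Bool) (cv : Fin n → Bool) (x : Fin n → Bool) (k : Fin n) :
    bitVal (stake (affineStrategy A cv) x k) = aff A cv x k := by
  rw [stake_affineStrategy, bitVal_xor, bitVal_rowParity]; rfl

/-- `dot2` in `𝔽₂`. -/
theorem natCast_dot2 (v z : Fin n → Bool) : ((dot2 v z : ℕ) : ZMod 2) = ∑ j, bitVal (v j) * bitVal (z j) := by
  unfold dot2
  rw [ZMod.natCast_mod, natCast_card_filter]
  refine sum_congr rfl fun j _ => ?_
  cases v j <;> cases z j <;> simp [bitVal]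

/-- `dot2 v z = 1` iff the `𝔽₂`-sum is `1`. -/
theorem dot2_eq_one_iff (v z : Fin n → Bool) : dot2 v z = 1 ↔ ∑ j, bitVal (v j) * bitVal (z j) = 1 := by
  rw [← natCast_dot2]
  have hlt : dot2 v z < 2 := Nat.mod_lt _ two_pos
  constructor
  · intro h; rw [h]; rfl
  · intro h
    rcases Nat.lt_succ_iff.1 hlt |>.eq_or_lt with h1 | h1
    · exact h1
    · have h0 : dot2 v z = 0 := by omega
      rw [h0] at h; exact absurd h (by decide)

/-- **The win bit of an affine strategy on the odd class**: `WIN(x) ⟺ Σ_k J_k (c_k + Σ_i A_{ki} x_i) = 1`. -/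
theorem rel_affine_iff (hn : 3 ≤ n) (A : Fin n → Fin n → Bool) (cv : Fin n → Bool) (x : Fin n → Bool)
    (hodd : IsOdd x) : Rel x (affineStrategy A cv x) ↔ wval A cv (kline x) x = 1 := by
  rw [rel_iff_stake hn (affineStrategy A cv) x hodd, dot2_eq_one_iff]
  unfold wval
  simp_rw [bitVal_stake_affine]

/-- A flipped bit in `𝔽₂`. -/
theorem bitVal_flipAt (x : Fin n → Bool) (P : Finset (Fin n)) (i : Fin n) :
    bitVal (flipAt x P i) = bitVal (x i) + if i ∈ P then 1 else 0 := by
  unfold flipAt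
  by_cases h : i ∈ P
  · simp only [h, decide_true, if_true]; cases x i <;> decide
  · simp only [h, decide_false, if_false]; cases x i <;> decide

/-- Flipping the bits in `P` adds `Σ_{i ∈ P} A_{ki}` to the stake. -/
theorem aff_flipAt (A : Fin n → Fin n → Bool) (cv : Fin n → Bool) (x : Fin n → Bool) (P : Finset (Fin n))
    (k : Fin n) : aff A cv (flipAt x P) k = aff A cv x k + ∑ i ∈ P, bitVal (A k i) := by
  unfold aff
  simp_rw [bitVal_flipAt, mul_add, sum_add_distrib, mul_boole]
  rw [Finset.sum_ite_mem, univ_inter, add_assoc]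

/-- **Flip rule**: flipping the bits in `P` adds the column sums `Σ_{i ∈ P} colSum v i` to the pairing. -/
theorem wval_flipAt (A : Fin n → Fin n → Bool) (cv : Fin n → Bool) (v x : Fin n → Bool) (P : Finset (Fin n)) :
    wval A cv v (flipAt x P) = wval A cv v x + ∑ i ∈ P, colSum A v i := by
  unfold wval colSum
  simp_rw [aff_flipAt, mul_add, sum_add_distrib, mul_sum]
  rw [sum_comm]

/-- **Toggle rule**: toggling the VECTOR at `s` adds the stake `aff_s`. -/
theorem wval_flipAt_left (A : Fin n → Fin n → Bool) (cv : Fin n → Bool) (v x : Fin n → Bool) (s : Fin n) :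
    wval A cv (flipAt v {s}) x = wval A cv v x + aff A cv x s := by
  unfold wval
  simp_rw [bitVal_flipAt, add_mul, sum_add_distrib, mem_singleton, boole_mul]
  rw [Finset.sum_ite_eq' univ s, if_pos (mem_univ _)]

/-! ### Radius-1 read matrices -/

/-- A function supported on `{i-1, i, i+1}` sums to its three values (`n ≥ 3`). -/
theorem sum_eq_three (hn : 3 ≤ n) (i : Fin n) (f : Fin n → ZMod 2)
    (hf : ∀ k, k ≠ prv i → k ≠ i → k ≠ nxt i → f k = 0) : ∑ k, f k = f (prv i) + f i + f (nxt i) := by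
  have d1 : nxt i ≠ i := nxt_ne_self (by omega) i
  have d2 : prv i ≠ nxt i := prv_ne_nxt hn i
  have d3 : prv i ≠ i := fun h => d1 (prv_eq_iff.1 h).symm
  rw [← Finset.sum_subset (subset_univ ({prv i, i, nxt i} : Finset (Fin n)))
    (fun k _ hk => hf k (fun h => hk (by simp [h])) (fun h => hk (by simp [h])) (fun h => hk (by simp [h])))]
  rw [sum_insert (by simp [d2, d3]), sum_insert (by simp [d1.symm]), sum_singleton, add_assoc]

/-- "Not within distance 1" is symmetric. -/
theorem far_symm {i k : Fin n} (h1 : i ≠ prv k) (h2 : i ≠ k) (h3 : i ≠ nxt k) :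
    k ≠ prv i ∧ k ≠ i ∧ k ≠ nxt i :=
  ⟨fun h => h3 (prv_eq_iff.1 h.symm), fun h => h2 h.symm, fun h => h1 (nxt_eq_iff.1 h.symm)⟩

/-- Radius 1: the stake of bell `k` reads only `x_{k-1}, x_k, x_{k+1}`. -/
theorem aff_eq_three (hn : 3 ≤ n) {A : Fin n → Fin n → Bool} (hA : IsRadiusOne A) (cv : Fin n → Bool)
    (x : Fin n → Bool) (k : Fin n) :
    aff A cv x k = bitVal (cv k) + (bitVal (A k (prv k)) * bitVal (x (prv k)) + bitVal (A k k) * bitVal (x k) +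
      bitVal (A k (nxt k)) * bitVal (x (nxt k))) := by
  unfold aff
  rw [sum_eq_three hn k _ fun i h1 h2 h3 => by rw [hA k i h1 h2 h3]; simp [bitVal]]

/-- Radius 1: bit `i` is read only by the bells `i-1, i, i+1`. -/
theorem colSum_eq_three (hn : 3 ≤ n) {A : Fin n → Fin n → Bool} (hA : IsRadiusOne A) (v : Fin n → Bool)
    (i : Fin n) :
    colSum A v i = bitVal (v (prv i)) * bitVal (A (prv i) i) + bitVal (v i) * bitVal (A i i) +
      bitVal (v (nxt i)) * bitVal (A (nxt i) i) := by
  unfold colSum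
  rw [sum_eq_three hn i _ fun k h1 h2 h3 => by
    obtain ⟨e1, e2, e3⟩ := far_symm h1 h2 h3
    rw [hA k i e1 e2 e3]; simp [bitVal]]

/-- Radius 1, at a particle `i` of a hard-core `v`: `colSum v i = κ_i`. -/
theorem colSum_particle (hn : 3 ≤ n) {A : Fin n → Fin n → Bool} (hA : IsRadiusOne A) {v : Fin n → Bool}
    (hv : HardCore v) {i : Fin n} (hi : v i = false) : colSum A v i = kap A i := by
  rw [colSum_eq_three hn hA v i, hv.prv_eq_true hi, hv.nxt_eq_true hi, hi]
  unfold kap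
  simp [bitVal]

/-- Every element of `𝔽₂` is `0` or `1`; bookkeeping for "the win bit flips". -/
theorem add_one_eq_one_iff : ∀ w : ZMod 2, w + 1 = 1 ↔ ¬ w = 1 := by
  decide

/-- Distinct elements of `𝔽₂` sum to `1`. -/
theorem add_eq_one_of_ne : ∀ a b : ZMod 2, a ≠ b → a + b = 1 := by
  decide

end Summit.QuantumAdvantage.AdviceFreeQNC0.Fib19
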